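import Literature.Computability.QuantumComplexity.PPPostBQPEvents
import Literature.Computability.QuantumComplexity.PPPostBQPCoreUniform
import Literature.Computability.QuantumComplexity.PostBQPToPostIQPProofs
import Literature.Computability.QuantumComplexity.RevCleanPoly
import Literature.Computability.Complexity.FoldBricks
import Literature.Computability.Complexity.KannanLanguage
import HarnessLib

/-!
# `PP ⊆ PostBQP`, IX: the classical read-out and Aaronson's inclusion `PP ⊆ PostBQP`

Topic `Literature/Computability/QuantumComplexity`; last file of the series proving Aaronson's
`PP ⊆ PostBQP` (S. Aaronson, Proc. R. Soc. A 461 (2005), Thm. 4 `PostBQP = PP`, the direction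
proved on pp. 5–6 of arXiv:quant-ph/0412187; plan and the precise relation to the printed proof
in `PPPostBQPScales.lean`). The `PostBQP` family is the classical wrapping
(`Cryptography.PostBPPSim.exists_wrap` = the tree's `CWrap.family`, Bernstein–Vazirani 1997, §8)
of the quantum core `Core.family` (files V–VII) by the identity pre-processor and the
**read-out** `decF`: a polynomial-time string function writing onto wire `0` the bit
"all signs `0` (and the register is in the post-selection pattern)" and onto wire `1` the bit
"the signs are unanimous (and the pattern holds)" — Aaronson's "at the end, we compute the AND
of the ancilla qubits, and swap the result into the first qubit" (§3). By the probabilities of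
file VIII and the exactness lemmas of `PostselectionPostBQPProofs.lean` the wrapped family has
`Pr[post] = κ (plusW + minusW)` and `Pr[out ∧ post] = κ · plusW`, so that the conditional
acceptance probability is `plusW / (plusW + minusW)`, `≥ 2/3` on `x ∈ L` and `≤ 1/3` off `L` by the
product test (files I, III).

Main result: **`PP_subset_PostBQP : PP ⊆ PostBQP`**.

## References

* S. Aaronson, *Quantum computing, postselection, and probabilistic polynomial-time*, Proc. R.
  Soc. A 461 (2005) 3473–3482, doi:10.1098/rspa.2005.1546, arXiv:quant-ph/0412187: Def. 1, §3,
  Thm. 4 and its proof.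
* E. Bernstein, U. Vazirani, *Quantum complexity theory*, SIAM J. Comput. 26 (1997), §8.
* M. J. Bremner, R. Jozsa, D. J. Shepherd, Proc. R. Soc. A 467 (2011), Thm. 1 (consumer:
  `post-IQP = post-BQP = PP`).
-/

noncomputable section

namespace Literature.Computability.QuantumComplexity

namespace PPPostBQP

namespace Core

open Complexity Complexity.Brick Complexity.Plumb Cryptography RevSim RevClean CWrap _root_.Computability
  Cryptography.PostBPPSim Polynomial

variable (Q : Core)

/-! ### The sizes as polynomials -/

/-- `bods = K · B` as a polynomial. [folklore] -/
def bodsPoly : Polynomial ℕ := (Q.p + C 2) * ((Q.p + C 3) + ((Q.p + C 1) + C 1))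
/-- `ρ` as a polynomial. [folklore] -/
def rhoPoly : Polynomial ℕ := (Q.p + C 2) + Q.bodsPoly
/-- `nT` as a polynomial. [folklore] -/
def nTPoly : Polynomial ℕ := (X + Q.rhoPoly) + (C 2 * X + C 2)
/-- `resStart = NN (nT)` as a polynomial. [folklore] -/
def resStartPoly : Polynomial ℕ := (NNPoly Q.e Q.M).comp Q.nTPoly

/-- value of `bodsPoly` [folklore] -/
@[simp] theorem eval_bodsPoly (n : ℕ) : Q.bodsPoly.eval n = Q.bods n := by
  unfold bodsPoly bods Core.K bodyLen
  rw [bodiesLen_eq]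
  simp
/-- value of `rhoPoly` [folklore] -/
@[simp] theorem eval_rhoPoly (n : ℕ) : Q.rhoPoly.eval n = Q.rho n := by
  unfold rhoPoly rho Core.K
  simp
/-- value of `nTPoly` [folklore] -/
@[simp] theorem eval_nTPoly (n : ℕ) : Q.nTPoly.eval n = Q.nT n := by
  unfold nTPoly nT n0
  simp [length_vg]
/-- value of `resStartPoly` [folklore] -/
@[simp] theorem eval_resStartPoly (n : ℕ) : Q.resStartPoly.eval n = Q.resStart n := by
  unfold resStartPoly resStart
  rw [Polynomial.eval_comp, eval_nTPoly, eval_NNPoly]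

/-! ### The post-selection pattern of the result zone as a string -/

/-- The position of the `true`-code wire inside a cell. [folklore] -/
def t0 : ℕ := (eA Q.M (symTrue Q.M) : ℕ)

/-- The pattern of one cell: the indicator of position `t0`. [folklore] -/
def cellPat : List Bool := (List.range (A₁ Q.M)).map fun c => decide (c = Q.t0)

/-- The pattern of the result zone: `K` cells. [folklore] -/
def patStr (n : ℕ) : List Bool := ccat (fun _ => Q.cellPat) (Q.K n)

/-- Length of `k` cells. [folklore] -/
theorem length_ccat_cellPat (k : ℕ) : (ccat (fun _ => Q.cellPat) k).length = k * A₁ Q.M := by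
  induction k with
  | zero => simp
  | succ k ih => rw [ccat_succ, List.length_append, ih, Nat.succ_mul]; simp [cellPat]

/-- Length of the pattern. [folklore] -/
theorem length_patStr (n : ℕ) : (Q.patStr n).length = Q.K n * A₁ Q.M := Q.length_ccat_cellPat _

/-- The bits of `k` cells: `1` exactly at the positions `≡ t0 (mod A₁)`. [folklore] -/
theorem getD_ccat_cellPat : ∀ (k : ℕ) {i : ℕ}, i < k * A₁ Q.M →
    (ccat (fun _ => Q.cellPat) k).getD i false = decide (i % A₁ Q.M = Q.t0)
  | 0, i, hi => by simp at hi
  | k + 1, i, hi => by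
    have hlen := Q.length_ccat_cellPat k
    rw [ccat_succ]
    by_cases h : i < k * A₁ Q.M
    · rw [List.getD_append _ _ _ _ (by rw [hlen]; exact h), getD_ccat_cellPat k h]
    · rw [List.getD_append_right _ _ _ _ (by rw [hlen]; omega), hlen]
      have hc : i - k * A₁ Q.M < A₁ Q.M := by rw [Nat.succ_mul] at hi; omega
      unfold cellPat
      rw [List.getD_eq_getElem _ _ (by simpa using hc)]
      simp only [List.getElem_map, List.getElem_range]
      congr 1
      apply propext
      rw [show i = (i - k * A₁ Q.M) + k * A₁ Q.M by omega, Nat.add_mul_mod_self_right, Nat.add_sub_cancel,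
        Nat.mod_eq_of_lt hc]

/-- The bits of the pattern. [folklore] -/
theorem getD_patStr (n : ℕ) {i : ℕ} (hi : i < Q.K n * A₁ Q.M) : (Q.patStr n).getD i false = decide (i % A₁ Q.M = Q.t0) :=
  Q.getD_ccat_cellPat _ hi

/-- The positional pattern of `Ev` is the residue test. [folklore] -/
theorem isT_iff_mod (n : ℕ) {i : ℕ} (h1 : Q.resStart n ≤ i) (h2 : i < Q.resStart n + Q.resLen n) :
    (∃ j < Q.K n, i = resW Q.e Q.M (Q.nT n) j (symTrue Q.M)) ↔ (i - Q.resStart n) % A₁ Q.M = Q.t0 := by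
  have hA := one_le_A₁ (M := Q.M)
  have ht : Q.t0 < A₁ Q.M := (eA Q.M (symTrue Q.M)).isLt
  unfold resStart resLen at *
  constructor
  · rintro ⟨j, -, rfl⟩
    unfold resW
    rw [show NN Q.e Q.M (Q.nT n) + (j * A₁ Q.M + ↑(eA Q.M (symTrue Q.M))) - NN Q.e Q.M (Q.nT n) =
      ↑(eA Q.M (symTrue Q.M)) + j * A₁ Q.M by omega, Nat.add_mul_mod_self_right]
    exact Nat.mod_eq_of_lt ht
  · intro h
    refine ⟨(i - NN Q.e Q.M (Q.nT n)) / A₁ Q.M, ?_, ?_⟩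
    · exact Nat.div_lt_of_lt_mul (by rw [Nat.mul_comm]; omega)
    · unfold resW; unfold t0 at h
      have := Nat.div_add_mod (i - NN Q.e Q.M (Q.nT n)) (A₁ Q.M)
      rw [Nat.mul_comm] at this; omega

/-! ### The events through segments -/

/-- A segment of a long enough string equals a `map` of `range` iff its bits are as mapped. [folklore] -/
theorem take_drop_eq_iff {l : List Bool} {a k : ℕ} (hk : a + k ≤ l.length) (g : ℕ → Bool) :
    (l.drop a).take k = (List.range k).map g ↔ ∀ j < k, l.getD (a + j) false = g j := by
  constructor
  · intro h j hj
    have := congrArg (fun l' => l'.getD j false) h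
    rw [List.getD_eq_getElem _ _ (by simp; omega), List.getElem_take, List.getElem_drop,
      List.getD_eq_getElem _ _ (by simpa using hj), List.getElem_map, List.getElem_range] at this
    rw [List.getD_eq_getElem _ _ (by omega)]
    exact this
  · intro h
    apply List.ext_getElem (by simp; omega)
    intro j h1 h2
    rw [List.getElem_take, List.getElem_drop, List.getElem_map, List.getElem_range, ← h j (by simpa using h2),
      List.getD_eq_getElem _ _ (by simp at h1; omega)]

/-- `replicate` as a `map` over `range`. [folklore] -/
theorem replicate_eq_map_range (k : ℕ) (b : Bool) : List.replicate k b = (List.range k).map fun _ => b := by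
  rw [List.map_const', List.length_range]

/-- **The event of the sign pattern `b` through segments** (a Boolean function of all strings):
signs, bodies, result zone. [cite: Aaronson2005, Thm. 4 (proof)] -/
def evSeg (n : ℕ) (b : Bool) (l : List Bool) : Bool :=
  decide ((l.drop n).take (Q.K n) = List.replicate (Q.K n) b) &&
    decide ((l.drop (n + Q.K n)).take (Q.bods n) = List.replicate (Q.bods n) false) &&
      decide ((l.drop (Q.resStart n)).take (Q.K n * A₁ Q.M) = Q.patStr n)

/-- **On strings of the register length, the segment event is the event `Ev` of file VIII.** [folklore] -/
theorem evSeg_eq_true_iff {n : ℕ} (b : Bool) {l : List Bool} (hl : Q.W n ≤ l.length) :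
    Q.evSeg n b l = true ↔ l ∈ Ev Q n b := by
  have h1 := Q.n0_le_W n
  have h2 := Q.resStart_add_resLen_le n
  unfold n0 rho at h1; unfold resLen at h2
  unfold evSeg Ev
  rw [Bool.and_eq_true, Bool.and_eq_true, decide_eq_true_eq, decide_eq_true_eq, decide_eq_true_eq,
    replicate_eq_map_range, replicate_eq_map_range, take_drop_eq_iff (by omega), take_drop_eq_iff (by omega),
    show Q.patStr n = (List.range (Q.K n * A₁ Q.M)).map fun i => decide (i % A₁ Q.M = Q.t0) from
      List.ext_getElem (by rw [length_patStr]; simp) fun i hi _ => by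
        rw [length_patStr] at hi
        rw [← List.getD_eq_getElem _ false (by rw [length_patStr]; exact hi), getD_patStr _ n hi]; simp,
    take_drop_eq_iff (by omega), Set.mem_setOf_eq, and_assoc]
  have hρ : Q.rho n = Q.K n + Q.bods n := rfl
  refine and_congr Iff.rfl (and_congr ⟨fun h i hi1 hi2 => ?_, fun h j hj => h _ (by omega) (by omega)⟩
    ⟨fun h i hi1 hi2 => ?_, fun h j hj => ?_⟩)
  · have := h (i - (n + Q.K n)) (by omega); rwa [show n + Q.K n + (i - (n + Q.K n)) = i by omega] at this
  · have := h (i - Q.resStart n) (by unfold resLen at hi2; omega)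
    rw [show Q.resStart n + (i - Q.resStart n) = i by omega] at this
    rw [this]
    exact Bool.decide_congr (Q.isT_iff_mod n hi1 hi2).symm
  · rw [h _ (by omega) (by unfold resLen; omega)]
    exact Bool.decide_congr ((Q.isT_iff_mod n (by omega) (by unfold resLen; omega)).trans (by
      rw [Nat.add_sub_cancel_left]))

/-- The segment events as sets. [folklore] -/
def EvS (n : ℕ) (b : Bool) : Set (List Bool) := {l | Q.evSeg n b l = true}

variable {Q}

/-- Kernel probabilities depend only on the strings of the register length. [folklore] -/
theorem kernelProb_congr (W : QCircuitFamily cliffordT) (x : List Bool) {A B : Set (List Bool)}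
    (h : ∀ l : List Bool, l.length = x.length + W.ancillas x.length → (l ∈ A ↔ l ∈ B)) :
    W.kernelProb 0 x A = W.kernelProb 0 x B := by
  classical
  rw [kernelProb_eq_sum, kernelProb_eq_sum]
  refine Finset.sum_congr rfl fun z _ => ?_
  rw [show (List.ofFn z ∈ A) = (List.ofFn z ∈ B) from propext (h _ (List.length_ofFn))]

/-- The segment event has the probability of `Ev`. [folklore] -/
theorem kernelProb_EvS (x : List Bool) (b : Bool) :
    Q.family.kernelProb 0 x (Q.EvS x.length b) = Q.family.kernelProb 0 x (Ev Q x.length b) :=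
  kernelProb_congr _ x fun l hl => Q.evSeg_eq_true_iff b (by rw [hl, Q.n_add_anc])

/-- The union of the segment events has the probability of the union. [folklore] -/
theorem kernelProb_EvS_union (x : List Bool) :
    Q.family.kernelProb 0 x (Q.EvS x.length false ∪ Q.EvS x.length true) =
      Q.family.kernelProb 0 x (Ev Q x.length false ∪ Ev Q x.length true) :=
  kernelProb_congr _ x fun l hl => by
    simp only [Set.mem_union]
    rw [show l ∈ Q.EvS x.length false ↔ l ∈ Ev Q x.length false from Q.evSeg_eq_true_iff false (by rw [hl, Q.n_add_anc]),
      show l ∈ Q.EvS x.length true ↔ l ∈ Ev Q x.length true from Q.evSeg_eq_true_iff true (by rw [hl, Q.n_add_anc])]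

/-! ### The read-out as a brick -/

variable (Q)

/-- A ruler `1^{q(|x|)}` read off the first field. [folklore] -/
def rul (q : Polynomial ℕ) : List Bool → List Bool := polyFn q ∘ fstF

/-- The segment `(l ⇂ a(|x|)) ↾ k(|x|)` of the second field. [folklore] -/
def segF (a k : Polynomial ℕ) : List Bool → List Bool :=
  takeFn ∘ fanoutFn (rul k) (dropFn ∘ fanoutFn (rul a) sndF)

/-- Value of `segF`. [folklore] -/
theorem segF_boolPair (a k : Polynomial ℕ) (x l : List Bool) :
    segF a k (boolPair x l) = (l.drop (a.eval x.length)).take (k.eval x.length) := by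
  simp [segF, rul]

/-- `rul q ∈ FP`. [folklore] -/
theorem rul_mem_FP (q : Polynomial ℕ) : rul q ∈ FP := comp_mem_FP (polyFn_mem_FP _) fstF_mem_FP

/-- `segF ∈ FP`. [folklore] -/
theorem segF_mem_FP (a k : Polynomial ℕ) : segF a k ∈ FP :=
  comp_mem_FP takeFn_mem_FP (fanoutFn_mem_FP (rul_mem_FP k)
    (comp_mem_FP dropFn_mem_FP (fanoutFn_mem_FP (rul_mem_FP a) sndF_mem_FP)))

/-- The record `⟨x, ⟨bin K, ⟨ε, ε⟩⟩⟩` starting the pattern fold. [folklore] -/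
def patInit : List Bool → List Bool :=
  fanoutFn fstF (fanoutFn (lenBinF ∘ rul (Q.p + C 2)) (fanoutFn (fun _ => []) (fun _ => [])))

/-- The pattern string as a brick: `K` copies of the cell pattern, by the concatenation fold. [folklore] -/
def patF : List Bool → List Bool := sndPow 2 ∘ foldLoop appF (fun _ => Q.cellPat) (Q.p + C 2) ∘ Q.patInit

/-- Value of `patInit`. [folklore] -/
theorem patInit_boolPair (x l : List Bool) :
    Q.patInit (boolPair x l) = boolPair x (boolPair (encodeNat (Q.K x.length)) (boolPair (ones 0) [])) := by
  simp [patInit, rul, Core.K]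

/-- Value of `patF`. [folklore] -/
theorem patF_boolPair (x l : List Bool) : Q.patF (boolPair x l) = Q.patStr x.length := by
  unfold patF
  rw [Function.comp_apply, Function.comp_apply, patInit_boolPair,
    foldLoop_apply _ _ (by simp [Core.K]) 0 [], sndPow_succ_boolPair, sndPow_succ_boolPair, sndPow_zero_boolPair,
    foldAcc_appF]
  simp [patStr]

/-- `patF ∈ FP`. [folklore] -/
theorem patF_mem_FP : Q.patF ∈ FP := by
  have hloop : foldLoop appF (fun _ => Q.cellPat) (Q.p + C 2) ∈ FP :=
    foldLoop_mem_FP (C := Q.cellPat.length) appF_mem_FP length_appF_le (const_mem_FP _)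
      (fun w => Nat.le_mul_of_pos_right _ (Nat.succ_pos _)) _
  have hinit : Q.patInit ∈ FP :=
    fanoutFn_mem_FP fstF_mem_FP (fanoutFn_mem_FP (comp_mem_FP lenBinF_mem_FP (rul_mem_FP _))
      (fanoutFn_mem_FP (const_mem_FP _) (const_mem_FP _)))
  exact comp_mem_FP (sndPow_mem_FP 2) (comp_mem_FP hloop hinit)

/-- Equality of the values of two bricks, as a one-bit condition. [folklore] -/
def eqC (f g : List Bool → List Bool) : List Bool → List Bool := eqPairFn ∘ fanoutFn f g

/-- Value of `eqC`. [folklore] -/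
@[simp] theorem eqC_apply (f g : List Bool → List Bool) (z : List Bool) : eqC f g z = [decide (f z = g z)] := by
  simp [eqC, eqPairFn_boolPair]

/-- `eqC ∈ FP`. [folklore] -/
theorem eqC_mem_FP {f g : List Bool → List Bool} (hf : f ∈ FP) (hg : g ∈ FP) : eqC f g ∈ FP :=
  comp_mem_FP eqPairFn_mem_FP (fanoutFn_mem_FP hf hg)

/-- **The segment event as a one-bit brick.** [cite: Aaronson2005, §3 (the AND of the post-selection flags)] -/
def evC : Bool → List Bool → List Bool
  | false => andFn (andFn (eqC (segF X (Q.p + C 2)) (Kannan.zerosFn ∘ rul (Q.p + C 2)))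
      (eqC (segF (X + (Q.p + C 2)) Q.bodsPoly) (Kannan.zerosFn ∘ rul Q.bodsPoly)))
      (eqC (segF Q.resStartPoly ((Q.p + C 2) * C (A₁ Q.M))) Q.patF)
  | true => andFn (andFn (eqC (segF X (Q.p + C 2)) (rul (Q.p + C 2)))
      (eqC (segF (X + (Q.p + C 2)) Q.bodsPoly) (Kannan.zerosFn ∘ rul Q.bodsPoly)))
      (eqC (segF Q.resStartPoly ((Q.p + C 2) * C (A₁ Q.M))) Q.patF)

/-- Value of `evC`. [folklore] -/
theorem evC_boolPair (b : Bool) (x l : List Bool) : Q.evC b (boolPair x l) = [Q.evSeg x.length b l] := by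
  cases b <;>
  · simp only [evC]
    unfold evSeg
    rw [andFn_apply (andFn_apply (eqC_apply _ _ _) (eqC_apply _ _ _)) (eqC_apply _ _ _)]
    simp only [segF_boolPair, eval_X, eval_add, eval_C, eval_mul, patF_boolPair, eval_resStartPoly, eval_bodsPoly,
      Function.comp_apply, Kannan.zerosFn_apply, rul, polyFn_apply, fstF_boolPair, List.length_replicate]
    rfl

/-- `evC b ∈ FP`. [folklore] -/
theorem evC_mem_FP (b : Bool) : Q.evC b ∈ FP := by
  have h2 : eqC (segF (X + (Q.p + C 2)) Q.bodsPoly) (Kannan.zerosFn ∘ rul Q.bodsPoly) ∈ FP :=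
    eqC_mem_FP (segF_mem_FP _ _) (comp_mem_FP Kannan.zerosFn_mem_FP (rul_mem_FP _))
  have h3 : eqC (segF Q.resStartPoly ((Q.p + C 2) * C (A₁ Q.M))) Q.patF ∈ FP := eqC_mem_FP (segF_mem_FP _ _) Q.patF_mem_FP
  cases b
  · exact andFn_mem_FP (andFn_mem_FP (eqC_mem_FP (segF_mem_FP _ _)
      (comp_mem_FP Kannan.zerosFn_mem_FP (rul_mem_FP _))) h2) h3
  · exact andFn_mem_FP (andFn_mem_FP (eqC_mem_FP (segF_mem_FP _ _) (rul_mem_FP _)) h2) h3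

/-- **The read-out**: wire `0` ← "all signs `0` and pattern", wire `1` ← "signs unanimous and pattern".
[cite: Aaronson2005, §3 (AND of the flags swapped into the first qubit) and Thm. 4 (proof)] -/
def decF : List Bool → List Bool := fun w => Q.evC false w ++ orFn (Q.evC false) (Q.evC true) w

/-- Value of the read-out on `⟨x, l⟩`. [folklore] -/
theorem decF_boolPair (x l : List Bool) :
    Q.decF (boolPair x l) = [Q.evSeg x.length false l, Q.evSeg x.length false l || Q.evSeg x.length true l] := by
  unfold decF
  rw [orFn_apply (Q.evC_boolPair false x l) (Q.evC_boolPair true x l), evC_boolPair, List.singleton_append]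

/-- **The read-out is polynomial time.** [cite: AroraBarak2009, §1.3] -/
theorem decF_mem_FP : Q.decF ∈ FP :=
  Complexity.append_mem_FP (Q.evC_mem_FP false) (orFn_mem_FP (Q.evC_mem_FP false) (Q.evC_mem_FP true))

end Core

/-! ### Aaronson's inclusion -/

open Complexity Cryptography Cryptography.PostBPPSim _root_.Computability Core

/-- **`PP ⊆ PostBQP`** (Aaronson 2005, Thm. 4, the direction `PP ⊆ PostBQP`; proved here by the
one-shot product-test variant of the printed algorithm described in `PPPostBQPScales.lean`): for
`L ∈ PP` with witness `(R, p)`, the classical wrapping of the quantum core of `(R, p)` by the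
read-out `decF` is an oracle-free, polynomial-time uniform Clifford+T family whose post-selection
probability on `x` is `κ (plusW + minusW) > 0` and whose joint acceptance probability is
`κ · plusW`; the conditional acceptance probability `plusW / (plusW + minusW)` is `≥ 2/3` iff-side
on `x ∈ L` (`G_x > 0`) and `≤ 1/3` on `x ∉ L` (`G_x < 0`). [cite: Aaronson2005, Thm. 4] -/
theorem PP_subset_PostBQP : PP ⊆ PostBQP := by
  rintro L ⟨R, hR, p, hw⟩
  obtain ⟨Q, hQR, hQp⟩ := exists_core hR p
  subst hQR; subst hQp
  obtain ⟨W, hWfree, hWU, hW⟩ := exists_wrap OracleCompose.id_mem_FP Q.decF_mem_FP Q.family_isOracleFree Q.family_isUniform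
  refine ⟨W, hWfree, hWU, fun x => ?_⟩
  -- the weights
  set κ : ℝ := (1 / 2 : ℝ) ^ Q.rho x.length * (1 / 2) ^ (S2 Q x.length).card with hκdef
  have hκ : 0 < κ := kappa_pos x
  have hsum := plusW_add_minusW_pos (Q := Q) x
  have key : ∀ E : Set (List Bool), Q.family.kernelProb 0 x E ≤
      W.kernelProb 0 x {z | ∃ y ∈ E, Q.decF (boolPair x y) <+: z} := fun E => hW x E
  have hread : ∀ (y z : List Bool), Q.decF (boolPair x y) <+: z →
      z[0]? = some (Q.evSeg x.length false y) ∧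
        z[1]? = some (Q.evSeg x.length false y || Q.evSeg x.length true y) := fun y z hz =>
    getElem?_of_pair_isPrefix _ _ _ (by rwa [Q.decF_boolPair] at hz)
  -- the post-selection probability
  have hpost : W.postselectProbOn 0 x = κ * (plusW Q.R Q.p x + minusW Q.R Q.p x) := by
    rw [postselectProbOn_eq_kernelProb]
    refine kernelProb_eq_of_le_of_compl_le W x (B := {w | w[1]? = some false}) ?_ ?_ ?_
    · intro w hw hw'
      rw [Set.mem_setOf_eq] at hw hw'
      rw [hw] at hw'; cases hw'
    · rw [← kernelProb_Ev_union, ← kernelProb_EvS_union]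
      refine (key _).trans (kernelProb_mono W x ?_)
      rintro z ⟨y, hy, hz⟩
      rw [Set.mem_setOf_eq, (hread y z hz).2]
      rcases hy with hy | hy
      · rw [show Q.evSeg x.length false y = true from hy]; rfl
      · rw [show Q.evSeg x.length true y = true from hy, Bool.or_true]
    · rw [← kernelProb_Ev_union, ← kernelProb_EvS_union, ← kernelProb_compl]
      refine (key _).trans (kernelProb_mono W x ?_)
      rintro z ⟨y, hy, hz⟩
      rw [Set.mem_compl_iff, Set.mem_union, not_or] at hy
      rw [Set.mem_setOf_eq, (hread y z hz).2, Bool.eq_false_iff.2 hy.1, Bool.eq_false_iff.2 hy.2]; rfl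
  -- the joint probability
  have hjoint : W.jointAcceptProbOn 0 x = κ * plusW Q.R Q.p x := by
    rw [jointAcceptProbOn_eq_kernelProb]
    refine kernelProb_eq_of_le_of_compl_le W x (B := {w | w[0]? = some false ∨ w[1]? = some false}) ?_ ?_ ?_
    · rintro w ⟨h0, h1⟩ (h' | h')
      · rw [h0] at h'; cases h'
      · rw [h1] at h'; cases h'
    · rw [← kernelProb_Ev_false, ← kernelProb_EvS]
      refine (key _).trans (kernelProb_mono W x ?_)
      rintro z ⟨y, hy, hz⟩
      have hy' : Q.evSeg x.length false y = true := hy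
      exact ⟨by rw [(hread y z hz).1, hy'], by rw [(hread y z hz).2, hy']; rfl⟩
    · rw [← kernelProb_Ev_false, ← kernelProb_EvS, ← kernelProb_compl]
      refine (key _).trans (kernelProb_mono W x ?_)
      rintro z ⟨y, hy, hz⟩
      have hy' : Q.evSeg x.length false y = false := Bool.eq_false_iff.2 hy
      left; rw [(hread y z hz).1, hy']
  -- the thresholds
  have hcond : W.condAcceptProbOn 0 x = plusW Q.R Q.p x / (plusW Q.R Q.p x + minusW Q.R Q.p x) := by
    show W.jointAcceptProbOn 0 x / W.postselectProbOn 0 x = _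
    rw [hpost, hjoint, mul_div_mul_left _ _ hκ.ne']
  refine ⟨by rw [hpost]; exact mul_pos hκ hsum, fun hx => ?_, fun hx => ?_⟩
  · rw [hcond]; exact cond_ge_two_thirds x ((gapG_pos_iff (hw x)).1 hx)
  · rw [hcond]; exact cond_le_one_third x ((gapG_neg_iff (hw x)).1 hx)

/-- **Aaronson's theorem reduced to its other half**: with `PP ⊆ PostBQP` proved, the named fact
`Cryptography.PostBQP_eq_PP` (Aaronson 2005, Thm. 4) follows from `PostBQP ⊆ PP` (Aaronson 2005,
Prop. 2) alone. [cite: Aaronson2005, Thm. 4] -/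
theorem PostBQP_eq_PP_of_subset (h : PostBQP ⊆ PP) : Cryptography.PostBQP_eq_PP :=
  Set.Subset.antisymm h PP_subset_PostBQP

/-- **Bremner–Jozsa–Shepherd's Theorem 1 (`PP ⊆ PostIQPWith ε`, the named fact
`PP_subset_PostIQPWith`) reduced to the Hadamard gadget alone**: `PP ⊆ PostBQP` (this file),
post-BQP error reduction (`PostBQP_subset_PostBQPWith_holds`), and the gadget
`PostBQPWith ε ⊆ PostIQPWith ε` (named fact `PostBQPWith_subset_PostIQPWith`).
[cite: BremnerJozsaShepherdPRSA2011, Thm. 1 (proof)] -/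
theorem PP_subset_PostIQPWith_of_gadget (hgadget : PostBQPWith_subset_PostIQPWith) : PP_subset_PostIQPWith :=
  fun ε hε0 hε1 _ hL => hgadget ε (PostBQP_subset_PostBQPWith_holds ε hε0 hε1 (PP_subset_PostBQP hL))

end PPPostBQP

end Literature.Computability.QuantumComplexity

end
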